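import Literature.MathematicalPhysics.QuantumFieldTheory.Balaban1983to89.B9SupplySockB9P3ZdSkewGaugeMode
import Literature.MathematicalPhysics.QuantumFieldTheory.Balaban1983to89.B8Ineq159FlatCubeMemberKernel

/-!
# `Balaban1983to89.B9Thm311FlatHermKernelZd` — [Balaban1985BackgroundPropagators] THEOREM 3.11 AT THE FLAT BACKGROUND ON PRINT'S CARRIER, KERNEL-CHECKED:
# at every cube member `{□_j}` of [Balaban1985RegularSpaces] (1.131), every truncation `m ≤ k`, for print's averaging class WITH the level-`0` crossing bonds
# (`cubeLamBP`), the GENUINE four-letter `Δ_a(1) = D*D + Δ′(1) + D R(1) 𝟙_{□₀}D* + Q*aQ(1)` (record `opsAllZd`) is POSITIVE DEFINITE on the HERMITIAN fields of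
# `E(□₀)`: `⟨A, Δ_a(1)A⟩_τ > 0` for every Hermitian `A ≠ 0` supported on the bonds of `□₀` — IDEA-3.11 step (i)_𝔤, the correctly-placed statement after this
# seat's two located obstructions (skew modes on the 𝔸-valued carrier, p601330; the Hermitian boundary mode at classes without crossing bonds, cube companion)

statement-level skeleton of published theorems with citation tags; proofs where landed; nothing here is a claim about the
Yang–Mills mass gap

`[Balaban1985BackgroundPropagators]` ("B9", CMP **99** (1985) 389–434) Thm 3.11 p. 416 *«the operators Δ′_a, G′, (Q′G′²Q′*)⁻¹, Δ_a, G are positive definite»* —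
proof, last lines: *«In [4] we have proved that the operator G_□(1) is positive»*; (3.26) p. 395, (3.16) p. 393, (3.20)–(3.22) p. 394, (3.115) p. 418;
`[Balaban1984PropagatorsII]` ("[4]" of B9's Thm 3.11 proof = B6, CMP **96**) (2.11) p. 225 *«the Laplace operator Δ is positive on the subspace N(Q′), hence it is invertible
on this subspace»*, (2.3), (2.7) p. 224; `[Balaban1985RegularSpaces]` ("B8") (1.131) p. 99, p. 77 (bond convention), (1.31) p. 82.

CITATION HEADER (lean-in-tree rule).  Cell `pub-ymgap` (YM Track A, HUMAN RULING D-0062 ∕ D-0149), node N06 = [B9]; seat `pub-ymgap-dag-n06-b` (g18), binder owner of the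
junction J-N06→N05.  TRIGGER: dag-n06-w2 g2's IDEA-3.11 step (i) «flat positivity at U₀ = 1 on E(Ω₀)» (the per-member compactness road to Theorem 3.11), taken by this
seat (w2: «Thm 3.11's per-member road is YOURS»; w4: «YOURS or a successor's»).  This seat first LOCATED that (i) is false as worded twice over — skew-Hermitian pure
gauges on the 𝔸-valued carrier (`B9SupplySockB9P3ZdSkewGaugeMode`, p601330) and the Hermitian boundary pure gauge `d𝟙_{Ω₀}` at classes without level-`0` crossing
bonds (`…SkewGaugeModeCube` §2) — and proves here the statement in print's own setting: Hermitian fields, class with crossing bonds.  The proof is an ASSEMBLY of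
tree objects: dag-n06-w4's energy identity and Landau square (`B9Eq326GaugeTermSquareZd.sum_finsum_pair_Jcur`, `finsum_re_trace_bond_DRD_eq_zero_iff`), the
`Δ^η`-energy identity (`B9Eq321LandauOrthogonalZd.finsum_pair_covLap_eq_sum`), this seat's summed pairing identity for the genuine `Q*aQ`
(`B9Eq316AveragingTransposeZdPrinted.tauForm_linCovIterT_pair`, applied with the trivial box law — at `U₀ = 1` the regime (1.7) holds for every domain sequence)
and its flat block-average formula (`…SkewGaugeMode.linCovIter_one_grad_alg`), dag-n05-w3's lattice Poincaré lemma and RAY ESCAPE (`B8FlatBondCalculusZd` §2,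
`B8Ineq159FlatCubeMemberKernel.ray_escape ∕ blockSum_eq_zero_of_classData`) — both PORTED here from the fibre `ℂ` to the non-commutative fibre `𝔸` (§0, §5), the
cube geometry of `B8Ineq159FlatCubeMemberKernel` §2 BY NAME — and w4's `projE` fixing the range generators (`…SkewGaugeMode.projR_covLap_eq_indicator_of_gaugeNull`).

WHAT IS PROVED (kernel, 0 sorry; theorems only (+ private helpers); no `def`, no `instance`, no `notation`).
* §0 `sum_range_transverse_diff_eq'`, ★★`exists_grad_of_closed` (Poincaré with finite support on `ℤᵈ`, `d ≥ 2`, any additive fibre `V`, with a predicate transfer — so the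
  potential of a Hermitian-valued closed field is Hermitian-valued).
* §1 `re_trace_star_mul_self_nonneg'`, `eq_zero_of_re_trace_star_mul_self_eq_zero`, ★★`covDerivFwd_eq_zero_of_covLap_eq_zero_on` (supported in `Ω₀`, `Δ^η_{U₀}λ = 0` on
  `Ω₀` ⇒ `D^η_{U₀}λ = 0`; any unitary `U₀`), ★★`covDerivFwd_eq_zero_of_gaugeNull_of_projR_eq_zero` (`λ ∈ N_𝔤(Q′(U₀))`, `R(U₀)(Δλ) = 0` ⇒ `Dλ = 0`).
* §2 `norm_linCovIter_one_le` (with `B7Prop3Flat.linQ_csmul` BY NAME), ★`linCovIter_one_smul_complex` (flat composite `ℂ`-homogeneous on bounded fields).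
* §3 `bondPair_eq_sum_of_vanish_off`, ★★`bondPair_QQZdP_one_eq` (`⟨A, Q*aQ(1)A⟩_τ = η·Σ_{j≤m} w_j Σ_{Λ_j} Re τ|LʲηQ_j(1)A|²` for the genuine letter at a member with
  finite class sets, ANY class).
* §4 `wQ_pos`, ★★★`kernel_conditions_of_bondPair_nonpos` (any member with finite `Ω₀` and finite class sets, any `A ∈ E(Ω₀)`: `⟨A, Δ_a(1)A⟩_τ ≤ 0` ⇒ `A` closed ∧
  `R(1)(D*A) = 0` ∧ every class average of `A` vanishes).
* §5 `ray_escape_fibre`, `sum_blockSites_pow_succ_fibre`, ★★`blockSum_eq_zero_of_classData_fibre` (dag-n05-w3's combinatorial heart, fibre `V`).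
* §6 `covDivB_smul_real`, `projR_smul_real`, `cubeLamBP_finite`, ★★★`flat_kernel_herm_cube` (cube member, `m ≤ k`, class `cubeLamBP`, Hermitian `A ∈ E(□₀)`,
  `⟨A, Δ_a(1)A⟩_τ ≤ 0` ⇒ `A = 0`), ★★★`flat_posDef_herm_cube` (`A ≠ 0` ⇒ `0 < ⟨A, Δ_a(1)A⟩_τ`).

HONEST SCOPE.  (i) This is Theorem 3.11's positivity of `Δ_a` at ONE background, `U = 1`, on the correct (𝔤-valued) carrier with print's class — the base case [4] of
print's proof («G_□(1) is positive»), at the tree's cube members; it is NOT Theorem 3.11 (curved `U₀` in the class (3.35), `M ≥ M₀`, `α₀ ≤ α₀′`, uniformity) and NOT a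
quantitative lower bound; steps (ii) continuity ∕ (iii) gauge covariance of IDEA-3.11, and `HermPreservingAt`∕`LinearOnDomAt` for `opsAllZd` (to turn positivity on
`E_𝔤` into `RegularAtH`∕`InvAtH` via `B9Eq327GreenZdHerm.regularAtH_of_bondPair_pos`), remain.  (ii) Count-neutral; N05 ∕ N06 NOT discharged; K1⁷
`stmt-QuantumFields-20542` NOT closed; 28∕28 · 5∕27 UNMOVED; one finite `𝕋⁴` programme at fixed `ε`, Bałaban as printed; nothing continuum ∕ ℝ⁴ ∕ OS ∕ mass gap ∕ Clay —
R4 closes the conditional finite-`𝕋⁴` rung `BalabanLadder.UV` only.  Unit `pub-ymgap-dag-n06-b` (g18), 2026-08-28.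
-/

noncomputable section

namespace Literature.MathematicalPhysics.QuantumFieldTheory.Balaban1983to89.B9Thm311FlatHermKernelZd

open B7Prop1Explicit
open B7Prop2Explicit (unitaryUnits)
open B7Eq78Linearization (conjR)
open B8Ineq132 (covDerivFwd covDeriv BondTouches)
open B8Eq138LandauZd (covDivB covLap)
open B9Eq321LandauProjectionZd (gaugeNull projR)
open B9Eq321LandauOrthogonalZd (finsum_pair_covLap_eq_sum support_covDerivFwd_finite)
open B9Eq326GaugeTermSquareZd (re_trace_star_pair_invariant)
open B9Eq316AveragingTransposeZd (tauForm tauForm_apply)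
open B9SupplySockB9P3ZdSkewGaugeMode (projR_covLap_eq_indicator_of_gaugeNull linCovIterT_zero_field)
open B7Prop4GeneralLevels (linCovIter linCovIter_zero linCovIter_succ)
open B7Prop3GeneralLinear (linQcov_one_left)
open B7Prop3Flat (linQ)
open B8Eq146AExpansion (iEta plaqCovDeriv)
open B8Eq155JBound (Jcur)
open B8LeafModelZd (ZdIdx)
open B9SupplySockB9P3ZdLetters (OpsZd deltaAOf)
open B9Eq327GreenZd (domSub bondPair setOf_bondTouches_finite support_finite_of_mem_domSub bondPair_deltaAOf_eq_four_terms)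
open B9Eq326GaugeTermSquareZd (sum_finsum_pair_Jcur finsum_re_trace_bond_DRD_nonneg finsum_re_trace_bond_DRD_eq_zero_iff)
open B9Eq316AveragingTransposeZd (clsField linCovIterT wQ Reg17 alphaQ alphaQ_pos reg17_one tauForm_isSymm)
open B9Eq316AveragingTransposeZdPrinted (QQZdP QQZdP_of_reg17 tauForm_linCovIterT_pair)
open B9Eq369CurvSmallZd (DpZd_one)
open B9Eq321LandauProjectionZd (opsLandau_DRDs_of_finite)
open B9SupplySockB9P3ZdAllLettersZd (opsAllZd opsAllZd_Dp opsAllZd_QQ opsAllZd_DRDs)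
open B7Prop1Local (InBox loK bondHiK add_e_apply add_zsmul_e_apply)
open B8Eq131Cubes (cube sqLo sqHi inLo inHi)
open B8Ineq159FlatCubeMemberPrinted (cubeLamBP)
open B8Ineq159FlatCubeMemberKernel (mem_cube_zero_iff inBox_in_zero_iff inBox_sq_succ_blockMap_of_inBox_in blockMap_eq_of_mem_blockSites)
open B8FlatBondCalculusZd (not_inBox_of_hi_lt not_inBox_of_lt_lo sum_blockSites_one)
open Literature.MathematicalPhysics.QuantumLattice (blockMap blockSites mem_blockSites_iff)

export B7Prop1Explicit (Site)

variable {d : ℕ} {𝔸 : Type*} [CStarAlgebra 𝔸]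


/-! ## §0 The lattice Poincaré lemma with finite support, arbitrary additive fibre (port of dag-n05-w3's ℂ-valued `B8FlatBondCalculusZd` §2) -/

section Poincare

variable {V : Type*} [AddCommGroup V]

/-- **Telescoping a closed field along a ray** (fibre-free form): for a bond field `φ` with `φ_ν(x + e_μ) − φ_ν(x) = φ_μ(x + e_ν) − φ_μ(x)` (closedness,
[B9] (3.4) at `U₀ = 1`), `Σ_{t<n} (φ₀(x + e_κ + te₀) − φ₀(x + te₀)) = φ_κ(x + ne₀) − φ_κ(x)`. [cite: Balaban1985BackgroundPropagators, (3.4) p.391] -/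
theorem sum_range_transverse_diff_eq' {φ : Site d → Fin d → V}
    (hF : ∀ μ ν x, φ (x + e μ) ν - φ x ν = φ (x + e ν) μ - φ x μ) (i₀ κ : Fin d) (x : Site d) (n : ℕ) :
    ∑ t ∈ Finset.range n, (φ (x + (t : ℤ) • e i₀ + e κ) i₀ - φ (x + (t : ℤ) • e i₀) i₀) =
      φ (x + (n : ℤ) • e i₀) κ - φ x κ := by
  have hterm : ∀ t : ℕ, φ (x + (t : ℤ) • e i₀ + e κ) i₀ - φ (x + (t : ℤ) • e i₀) i₀ =
      φ (x + ((t + 1 : ℕ) : ℤ) • e i₀) κ - φ (x + (t : ℤ) • e i₀) κ := by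
    intro t
    rw [hF κ i₀]
    congr 2
    push_cast; rw [add_smul, one_smul, add_assoc]
  simp_rw [hterm]
  rw [Finset.sum_range_sub (fun t : ℕ => φ (x + (t : ℤ) • e i₀) κ) n]
  simp

/-- ★★ **THE LATTICE POINCARÉ LEMMA WITH FINITE SUPPORT, ANY ADDITIVE FIBRE** (`d ≥ 2`): a bond field `φ : ℤᵈ × {directions} → V` vanishing on every bond not
touching the box `[lo, hi]` and CLOSED (`φ_ν(x + e_μ) − φ_ν(x) = φ_μ(x + e_ν) − φ_μ(x)`) is a pure gauge, `φ_κ(x) = λ(x + e_κ) − λ(x)`, of a site function `λ`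
SUPPORTED IN THE BOX — `λ(x) = −Σ_{t ≥ 0} φ₀(x + te₀)` (dag-n05-w3's `B8FlatBondCalculusZd.exists_eq_covDerivFwd_of_plaqCovDeriv_eq_zero` VERBATIM with the
fibre `ℂ` generalised and the step `η` dropped); moreover `λ` takes values in the additive subgroup generated by the values of `φ`, so it is Hermitian-valued
when `φ` is (`hP`). [cite: Balaban1985BackgroundPropagators, (3.4) p.391, p.418 («A → A − Dλ»); Balaban1984PropagatorsII, (2.11) p.225] -/
theorem exists_grad_of_closed (hd : 2 ≤ d) (lo hi : Site d) {φ : Site d → Fin d → V}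
    (hφ : ∀ x τ, ¬ B8Ineq132.BondTouches {y | InBox lo hi y} x τ → φ x τ = 0)
    (hF : ∀ μ ν x, φ (x + e μ) ν - φ x ν = φ (x + e ν) μ - φ x μ)
    (P : V → Prop) (hP0 : P 0) (hPadd : ∀ a b, P a → P b → P (a + b)) (hPneg : ∀ a, P a → P (-a)) (hPφ : ∀ x τ, P (φ x τ)) :
    ∃ lam : Site d → V, (∀ x κ, lam (x + e κ) - lam x = φ x κ) ∧ (∀ x, ¬ InBox lo hi x → lam x = 0) ∧ (∀ x, P (lam x)) := by
  classical
  set i₀ : Fin d := ⟨0, by omega⟩ with hi₀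
  set i₁ : Fin d := ⟨1, by omega⟩ with hi₁
  have h01 : i₁ ≠ i₀ := by rw [hi₀, hi₁]; simp [Fin.ext_iff]
  -- `φ` vanishes on a bond whose two ends are outside the box
  have hout : ∀ y μ, ¬ InBox lo hi y → ¬ InBox lo hi (y + e μ) → φ y μ = 0 := fun y μ h1 h2 =>
    hφ y μ (by rintro (h | h) <;> [exact h1 h; exact h2 h])
  set N : Site d → ℕ := fun x => (hi i₀ + 1 - x i₀).toNat with hN
  set lam : Site d → V := fun x => -∑ t ∈ Finset.range (N x), φ (x + (t : ℤ) • e i₀) i₀ with hlam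
  have hray : ∀ (x : Site d) (t : ℤ) (i : Fin d), (x + t • e i₀) i = x i + (if i = i₀ then t else 0) :=
    fun x t i => add_zsmul_e_apply x t i₀ i
  have hNtrans : ∀ (x : Site d) (κ : Fin d), κ ≠ i₀ → N (x + e κ) = N x := by
    intro x κ hκ
    simp only [hN, add_e_apply, if_neg (Ne.symm hκ), add_zero]
  have hend : ∀ (x : Site d) (κ : Fin d), φ (x + (N x : ℤ) • e i₀) κ = 0 := by
    intro x κ
    have hc : hi i₀ < (x + (N x : ℤ) • e i₀) i₀ := by
      rw [hray, if_pos rfl, hN]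
      simp only [Int.toNat_eq_max]
      rcases le_or_gt (hi i₀ + 1 - x i₀) 0 with h | h
      · rw [max_eq_right h]; omega
      · rw [max_eq_left h.le]; omega
    refine hout _ κ (not_inBox_of_hi_lt hc) (not_inBox_of_hi_lt (i := i₀) ?_)
    rw [add_e_apply]
    split_ifs <;> omega
  -- (P2) transverse derivatives
  have hP2 : ∀ (x : Site d) (κ : Fin d), κ ≠ i₀ → lam (x + e κ) - lam x = φ x κ := by
    intro x κ hκ
    have hpt : ∀ t : ℕ, x + e κ + (t : ℤ) • e i₀ = x + (t : ℤ) • e i₀ + e κ := fun t => by abel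
    simp only [hlam]
    rw [hNtrans x κ hκ]
    simp_rw [hpt]
    have := sum_range_transverse_diff_eq' hF i₀ κ x (N x)
    rw [Finset.sum_sub_distrib, hend, zero_sub] at this
    -- `-(Σ₁) - (-(Σ₂)) = -(Σ₁ - Σ₂) = -(-φ) = φ`
    rw [neg_sub_neg, ← neg_sub, this, neg_neg]
  -- (P1) the derivative along `e₀`
  have hP1 : ∀ x : Site d, lam (x + e i₀) - lam x = φ x i₀ := by
    intro x
    simp only [hlam]
    have hNs : N (x + e i₀) = (hi i₀ - x i₀).toNat := by
      simp only [hN, add_e_apply, if_true]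
      congr 1; ring
    rcases le_or_gt (x i₀) (hi i₀) with hle | hlt
    · have hNx : N x = (hi i₀ - x i₀).toNat + 1 := by
        simp only [hN]; omega
      rw [hNs, hNx, Finset.sum_range_succ']
      have hpt : ∀ t : ℕ, x + ((t + 1 : ℕ) : ℤ) • e i₀ = x + e i₀ + (t : ℤ) • e i₀ := fun t => by
        push_cast; rw [add_smul, one_smul]; abel
      simp_rw [hpt]
      simp only [Nat.cast_zero, zero_smul, add_zero]
      abel
    · have hNx : N x = 0 := by simp only [hN]; exact Int.toNat_eq_zero.2 (by omega)
      have hNs' : N (x + e i₀) = 0 := by rw [hNs]; exact Int.toNat_eq_zero.2 (by omega)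
      rw [hNx, hNs']
      simp only [Finset.sum_range_zero, neg_zero, sub_self]
      rw [hout x i₀ (not_inBox_of_hi_lt hlt) (not_inBox_of_hi_lt (i := i₀) (by rw [add_e_apply, if_pos rfl]; omega))]
  -- full line sums vanish below the box
  have hline : ∀ y : Site d, y i₀ < lo i₀ → ∑ t ∈ Finset.range (N y), φ (y + (t : ℤ) • e i₀) i₀ = 0 := by
    have hinv : ∀ (y : Site d) (κ : Fin d), κ ≠ i₀ → y i₀ < lo i₀ →
        ∑ t ∈ Finset.range (N (y + e κ)), φ (y + e κ + (t : ℤ) • e i₀) i₀ =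
          ∑ t ∈ Finset.range (N y), φ (y + (t : ℤ) • e i₀) i₀ := by
      intro y κ hκ hy
      have hpt : ∀ t : ℕ, y + e κ + (t : ℤ) • e i₀ = y + (t : ℤ) • e i₀ + e κ := fun t => by abel
      rw [hNtrans y κ hκ, ← sub_eq_zero, ← Finset.sum_sub_distrib]
      simp_rw [hpt]
      rw [sum_range_transverse_diff_eq' hF i₀ κ y (N y), hend, zero_sub, neg_eq_zero]
      refine hout y κ (not_inBox_of_lt_lo hy) (not_inBox_of_lt_lo (i := i₀) ?_)
      rw [add_e_apply, if_neg (Ne.symm hκ), add_zero]; exact hy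
    have hiter : ∀ (n : ℕ) (y : Site d), y i₀ < lo i₀ →
        ∑ t ∈ Finset.range (N (y + (n : ℤ) • e i₁)), φ (y + (n : ℤ) • e i₁ + (t : ℤ) • e i₀) i₀ =
          ∑ t ∈ Finset.range (N y), φ (y + (t : ℤ) • e i₀) i₀ := by
      intro n
      induction n with
      | zero => intro y _; simp
      | succ n ih =>
        intro y hy
        have hy' : (y + (n : ℤ) • e i₁) i₀ < lo i₀ := by
          rw [add_zsmul_e_apply, if_neg h01.symm, add_zero]; exact hy
        have h1 := hinv (y + (n : ℤ) • e i₁) i₁ h01 hy'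
        have hpt : y + ((n + 1 : ℕ) : ℤ) • e i₁ = y + (n : ℤ) • e i₁ + e i₁ := by
          push_cast; rw [add_smul, one_smul, add_assoc]
        rw [hpt, h1, ih y hy]
    intro y hy
    set n : ℕ := (hi i₁ + 1 - y i₁).toNat with hn
    rw [← hiter n y hy]
    refine Finset.sum_eq_zero fun t _ => ?_
    have hc : hi i₁ < (y + (n : ℤ) • e i₁ + (t : ℤ) • e i₀) i₁ := by
      rw [hray, if_neg h01, add_zero, add_zsmul_e_apply, if_pos rfl, hn]
      simp only [Int.toNat_eq_max]
      rcases le_or_gt (hi i₁ + 1 - y i₁) 0 with h | h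
      · rw [max_eq_right h]; omega
      · rw [max_eq_left h.le]; omega
    refine hout _ i₀ (not_inBox_of_hi_lt hc) (not_inBox_of_hi_lt (i := i₁) ?_)
    rw [add_e_apply, if_neg h01]; simpa using hc
  refine ⟨lam, fun x κ => ?_, fun x hx => ?_, fun x => ?_⟩
  · by_cases hκ : κ = i₀
    · subst hκ; exact hP1 x
    · exact hP2 x κ hκ
  · simp only [hlam]
    have hx' : ∃ i, x i < lo i ∨ hi i < x i := by
      by_contra h
      push Not at h
      exact hx fun i => ⟨(h i).1, (h i).2⟩
    obtain ⟨i, hci⟩ := hx'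
    by_cases hii : i = i₀
    · subst hii
      rcases hci with hlt | hgt
      · rw [hline x hlt, neg_zero]
      · have hNx : N x = 0 := by simp only [hN]; exact Int.toNat_eq_zero.2 (by omega)
        rw [hNx, Finset.sum_range_zero, neg_zero]
    · rw [Finset.sum_eq_zero fun t _ => ?_, neg_zero]
      have hc : ∀ s : ℤ, ¬ InBox lo hi (x + s • e i₀) := by
        intro s
        rcases hci with hlt | hgt
        · exact not_inBox_of_lt_lo (i := i) (by rw [hray, if_neg hii, add_zero]; exact hlt)
        · exact not_inBox_of_hi_lt (i := i) (by rw [hray, if_neg hii, add_zero]; exact hgt)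
      refine hout _ i₀ (hc t) ?_
      have : x + (t : ℤ) • e i₀ + e i₀ = x + ((t : ℤ) + 1) • e i₀ := by rw [add_smul, one_smul, add_assoc]
      rw [this]; exact hc _
  · simp only [hlam]
    refine hPneg _ (Finset.sum_induction _ P (fun a b ha hb => hPadd a b ha hb) hP0 fun t _ => hPφ _ _)


end Poincare

/-! ## §1 A function supported in `Ω₀` with `Δ^η_{U₀}λ = 0` on `Ω₀` has `D^η_{U₀}λ = 0` (energy identity, faithful tracial `τ`) -/

section Annihilate

variable {τ : 𝔸 →ₗ[ℂ] ℂ} (η : ℝ) {U₀ : Site d → Fin d → 𝔸ˣ}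

/-- `Re τ(a*a) ≥ 0` for a faithful `τ`. [cite: Balaban1985BackgroundPropagators, p.391 («X·Y = tr XY»)] -/
theorem re_trace_star_mul_self_nonneg' (hτp : ∀ a : 𝔸, a ≠ 0 → 0 < (τ (star a * a)).re) (a : 𝔸) : 0 ≤ (τ (star a * a)).re := by
  by_cases ha : a = 0
  · simp [ha]
  · exact (hτp a ha).le

/-- `Re τ(a*a) = 0 ⇒ a = 0` for a faithful `τ`. [cite: Balaban1985BackgroundPropagators, p.391 («X·Y = tr XY»)] -/
theorem eq_zero_of_re_trace_star_mul_self_eq_zero (hτp : ∀ a : 𝔸, a ≠ 0 → 0 < (τ (star a * a)).re) {a : 𝔸}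
    (h : (τ (star a * a)).re = 0) : a = 0 := by
  by_contra ha; exact absurd h (hτp a ha).ne'

/-- a finsum of nonnegative terms with finite support vanishes only if every term does. [folklore] [cite: Balaban1985BackgroundPropagators, (3.23) p.394 (bookkeeping)] -/
private theorem finsum_eq_zero_iff_of_nonneg' {ι : Type*} {f : ι → ℝ} (hf : (Function.support f).Finite) (h0 : ∀ i, 0 ≤ f i)
    (h : ∑ᶠ i, f i = 0) : ∀ i, f i = 0 := by
  classical
  rw [finsum_eq_sum_of_support_subset f (s := hf.toFinset) (by simp)] at h
  intro i
  by_cases hi : i ∈ hf.toFinset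
  · exact (Finset.sum_eq_zero_iff_of_nonneg fun j _ => h0 j).1 h i hi
  · simpa [Function.mem_support] using (mt hf.mem_toFinset.2 hi)

/-- ★★ **ENERGY: A FUNCTION SUPPORTED IN `Ω₀` WHOSE `Δ^η_{U₀}` VANISHES ON `Ω₀` IS COVARIANTLY CONSTANT** — `Σᶠ_x Re τ(λ(x)*(Δ^η_{U₀}λ)(x)) = Σ_μ Σᶠ_x Re τ(|(D^η_{U₀,μ}λ)(x)|²)`
(unitary `U₀`, tracial faithful `τ`) and the left side vanishes term by term. [cite: Balaban1985BackgroundPropagators, (3.23) p.394, Thm 3.11 p.416; Balaban1984PropagatorsII, (2.11) p.225 («the Laplace operator Δ is positive on the subspace N(Q′)»)] -/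
theorem covDerivFwd_eq_zero_of_covLap_eq_zero_on (hτt : ∀ a b : 𝔸, τ (a * b) = τ (b * a)) (hτp : ∀ a : 𝔸, a ≠ 0 → 0 < (τ (star a * a)).re)
    (hU : ∀ (x : Site d) (κ : Fin d), U₀ x κ ∈ unitaryUnits 𝔸) {s : Finset (Site d)} {lam : Site d → 𝔸}
    (hsupp : ∀ x, x ∉ s → lam x = 0) (h0 : ∀ x ∈ s, covLap η U₀ lam x = 0) :
    ∀ (μ : Fin d) (x : Site d), covDerivFwd η U₀ μ lam x = 0 := by
  classical
  have hlamf : (Function.support lam).Finite :=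
    s.finite_toSet.subset fun x hx => by by_contra h'; exact hx (hsupp x fun h => h' h)
  have hB : ∀ u ∈ unitaryUnits 𝔸, ∀ a b : 𝔸, tauForm τ (conjR u a) b = tauForm τ a (conjR u⁻¹ b) :=
    fun u hu a b => by rw [tauForm_apply, tauForm_apply]; exact re_trace_star_pair_invariant τ hτt hu a b
  have key := finsum_pair_covLap_eq_sum (tauForm τ) (unitaryUnits 𝔸) η U₀ hB hU (f := lam) (g := lam) hlamf hlamf
  -- the left side vanishes term by term
  have hL0 : ∑ᶠ x, tauForm τ (lam x) (covLap η U₀ lam x) = 0 := by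
    refine finsum_eq_zero_of_forall_eq_zero fun x => ?_
    by_cases hx : x ∈ s
    · rw [h0 x hx, map_zero]
    · rw [hsupp x hx, LinearMap.map_zero₂]
  rw [hL0] at key
  -- each summand on the right is `≥ 0`
  have hterm : ∀ (μ : Fin d) (x : Site d), 0 ≤ tauForm τ (covDerivFwd η U₀ μ lam x) (covDerivFwd η U₀ μ lam x) :=
    fun μ x => by rw [tauForm_apply]; exact re_trace_star_mul_self_nonneg' hτp _
  have hfs : ∀ μ : Fin d, (Function.support fun x => tauForm τ (covDerivFwd η U₀ μ lam x) (covDerivFwd η U₀ μ lam x)).Finite := by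
    intro μ
    refine (support_covDerivFwd_finite η U₀ μ hlamf).subset fun x hx => ?_
    rw [Function.mem_support] at hx ⊢
    intro h0'; exact hx (by rw [h0', map_zero])
  have hsum : ∀ μ : Fin d, ∑ᶠ x, tauForm τ (covDerivFwd η U₀ μ lam x) (covDerivFwd η U₀ μ lam x) = 0 := by
    have hnn : ∀ μ ∈ (Finset.univ : Finset (Fin d)), 0 ≤ ∑ᶠ x, tauForm τ (covDerivFwd η U₀ μ lam x) (covDerivFwd η U₀ μ lam x) :=
      fun μ _ => finsum_nonneg (hterm μ)
    exact fun μ => (Finset.sum_eq_zero_iff_of_nonneg hnn).1 key.symm μ (Finset.mem_univ μ)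
  intro μ x
  have h := finsum_eq_zero_iff_of_nonneg' (hfs μ) (hterm μ) (hsum μ) x
  rw [tauForm_apply] at h
  exact eq_zero_of_re_trace_star_mul_self_eq_zero hτp h

/-- ★★ **A GAUGE MODE FROM `N_𝔤(Q′(U₀))` KILLED BY THE LANDAU PROJECTION IS TRIVIAL**: for `λ ∈ N_𝔤(Q′(U₀))` (Hermitian, supported in `Ω₀`, block averages
zero on the `Λ_j`), `R(U₀)(Δ^η_{U₀}λ) = 0` forces `D^η_{U₀}λ = 0` — `R` FIXES `𝟙_{Ω₀}Δ^η_{U₀}λ` ((3.21): it is a generator of the range), so `Δ^η_{U₀}λ = 0` on `Ω₀`,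
and the energy identity finishes.  The positive mechanism of (3.26)'s `DRD*` on print's carrier. [cite: Balaban1985BackgroundPropagators, (3.21)–(3.22) p.394, (3.26) p.395, Thm 3.11 p.416] -/
theorem covDerivFwd_eq_zero_of_gaugeNull_of_projR_eq_zero [FiniteDimensional ℝ 𝔸] (hτt : ∀ a b : 𝔸, τ (a * b) = τ (b * a))
    (hτs : ∀ a : 𝔸, τ (star a) = starRingEnd ℂ (τ a)) (hτp : ∀ a : 𝔸, a ≠ 0 → 0 < (τ (star a * a)).re)
    (hU : ∀ (x : Site d) (κ : Fin d), U₀ x κ ∈ unitaryUnits 𝔸) {s : Finset (Site d)} {L m : ℕ} {Λs : ℕ → Set (Site d)}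
    {lam : Site d → 𝔸} (hlam : lam ∈ gaugeNull s L m Λs U₀) (hR : projR τ s L m η Λs U₀ (covLap η U₀ lam) = 0) :
    ∀ (μ : Fin d) (x : Site d), covDerivFwd η U₀ μ lam x = 0 := by
  have hind := projR_covLap_eq_indicator_of_gaugeNull τ (η := η) hτs hτp hlam
  rw [hR] at hind
  refine covDerivFwd_eq_zero_of_covLap_eq_zero_on η hτt hτp hU hlam.2.1 fun x hx => ?_
  have h := congrFun hind x
  rw [Pi.zero_apply, Set.indicator_of_mem (Finset.mem_coe.2 hx)] at h
  exact h.symm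

end Annihilate

/-! ## §2 Flat facts: complex homogeneity and a uniform bound for the composite averaging at `U₀ = 1` -/

section FlatHomog

variable [NormOneClass 𝔸]

/-- **THE FLAT COMPOSITE OF A BOUNDED FIELD IS BOUNDED BY `Lʲ` TIMES THE BOUND** ((126) iterated). [cite: Balaban1985Averaging, (126) p.36, (127) p.37] -/
theorem norm_linCovIter_one_le {L : ℕ} (hL : 1 ≤ L) {A : Site d → Fin d → 𝔸} {M₀ : ℝ} (hM₀ : 0 ≤ M₀) (hA : ∀ z κ, ‖A z κ‖ ≤ M₀) :
    ∀ (j : ℕ) (z : Site d) (κ : Fin d), ‖linCovIter L (1 : Site d → Fin d → 𝔸ˣ) A j z κ‖ ≤ (L : ℝ) ^ j * M₀ := by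
  intro j
  induction j with
  | zero => intro z κ; rw [linCovIter_zero, pow_zero, one_mul]; exact hA z κ
  | succ j ih =>
    intro z κ
    rw [linCovIter_succ, B7Eq92Concrete.avgIter_one, linQcov_one_left L hL _ (by positivity) ih]
    refine (B7Prop4Flat.norm_linQ_le_of_bound _ (by positivity) ih L hL _ κ).trans (le_of_eq ?_)
    rw [pow_succ]; ring

/-- ★ **THE FLAT COMPOSITE AVERAGING IS `ℂ`-HOMOGENEOUS** on bounded fields: `LʲηQ_j(1)(c·A) = c·LʲηQ_j(1)A`. [cite: Balaban1985Averaging, (122) + (125) p.36, (127) p.37] -/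
theorem linCovIter_one_smul_complex {L : ℕ} (hL : 1 ≤ L) (c : ℂ) {A : Site d → Fin d → 𝔸} {M₀ : ℝ} (hM₀ : 0 ≤ M₀) (hA : ∀ z κ, ‖A z κ‖ ≤ M₀) :
    ∀ (j : ℕ) (z : Site d) (κ : Fin d), linCovIter L (1 : Site d → Fin d → 𝔸ˣ) (c • A) j z κ = c • linCovIter L (1 : Site d → Fin d → 𝔸ˣ) A j z κ := by
  have hcA : ∀ z κ, ‖(c • A) z κ‖ ≤ ‖c‖ * M₀ := fun z κ => by
    rw [Pi.smul_apply, Pi.smul_apply, norm_smul]; exact mul_le_mul_of_nonneg_left (hA z κ) (norm_nonneg _)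
  intro j
  induction j with
  | zero => intro z κ; rfl
  | succ j ih =>
    intro z κ
    have hF : linCovIter L (1 : Site d → Fin d → 𝔸ˣ) (c • A) j = c • linCovIter L (1 : Site d → Fin d → 𝔸ˣ) A j := by
      funext w τ; rw [ih w τ]; rfl
    have hb := norm_linCovIter_one_le hL hM₀ hA j
    have hbc : ∀ w τ, ‖(c • linCovIter L (1 : Site d → Fin d → 𝔸ˣ) A j) w τ‖ ≤ ‖c‖ * ((L : ℝ) ^ j * M₀) := fun w τ => by
      rw [Pi.smul_apply, Pi.smul_apply, norm_smul]; exact mul_le_mul_of_nonneg_left (hb w τ) (norm_nonneg _)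
    rw [linCovIter_succ, linCovIter_succ, B7Eq92Concrete.avgIter_one, hF, linQcov_one_left L hL _ (by positivity) hbc,
      linQcov_one_left L hL _ (by positivity) hb, B7Prop3Flat.linQ_csmul]

end FlatHomog

/-! ## §3 The `Q*aQ` pairing at the flat background is a sum of squares over the class bonds -/

section Squares

variable (τ : 𝔸 →ₗ[ℂ] ℂ) [FiniteDimensional ℝ 𝔸]

omit [FiniteDimensional ℝ 𝔸] in
/-- a bond pairing against a field vanishing off a finite bond set is a finite sum over that set. [cite: Balaban1985BackgroundPropagators, (3.17) p.393 (bookkeeping)] -/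
theorem bondPair_eq_sum_of_vanish_off (S : Finset (Site d × Fin d)) {A : Site d → Fin d → 𝔸} (hA : ∀ b : Site d × Fin d, b ∉ S → A b.1 b.2 = 0)
    (G : Site d → Fin d → 𝔸) : bondPair τ A G = ∑ b ∈ S, tauForm τ (A b.1 b.2) (G b.1 b.2) := by
  classical
  rw [bondPair, ← Finset.sum_fiberwise S Prod.snd (fun b => tauForm τ (A b.1 b.2) (G b.1 b.2))]
  refine Finset.sum_congr rfl fun μ _ => ?_
  have hsupp : (Function.support fun x => (τ (star (A x μ) * G x μ)).re) ⊆ ↑((S.filter fun b => b.2 = μ).image Prod.fst) := by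
    intro x hx
    rw [Function.mem_support] at hx
    rw [Finset.coe_image, Set.mem_image]
    refine ⟨(x, μ), ?_, rfl⟩
    rw [Finset.mem_coe, Finset.mem_filter]
    refine ⟨?_, rfl⟩
    by_contra hb
    exact hx (by rw [hA (x, μ) hb, star_zero, zero_mul, map_zero, Complex.zero_re])
  rw [finsum_eq_sum_of_support_subset _ hsupp, Finset.sum_image]
  · refine Finset.sum_congr rfl fun b hb => ?_
    rw [Finset.mem_filter] at hb
    rw [tauForm_apply, ← hb.2]
  · intro b hb b' hb' h
    rw [Finset.mem_coe, Finset.mem_filter] at hb hb'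
    exact Prod.ext h (hb.2.trans hb'.2.symm)

variable {L : ℕ}

/-- ★★ **AT THE FLAT BACKGROUND `⟨A, Q*aQ(1)A⟩_τ = η·Σ_{j≤m} w_j Σ_{c ∈ Λ_j} Re τ(|(LʲηQ_j(1)A)(c)|²)`** for the genuine letter `QQZdP` at a member with finite class sets
— the summed pairing identity (`tauForm_linCovIterT_pair`, applied with trivial box law: at `U₀ = 1` the regime (1.7) holds for every domain sequence) and the
flat `ℂ`-homogeneity of the composite. [cite: Balaban1985BackgroundPropagators, (3.16) p.393, (3.17) p.393; Balaban1985Averaging, (127) p.37, (147) p.40] -/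
theorem bondPair_QQZdP_one_eq [Nontrivial 𝔸] (hτs : ∀ a : 𝔸, τ (star a) = starRingEnd ℂ (τ a)) (hτp : ∀ a : 𝔸, a ≠ 0 → 0 < (τ (star a * a)).re)
    (hL : 2 ≤ L) (ΛbP : ℕ → ℕ → Set (Site d × Fin d)) (i : ZdIdx d L) (m : ℕ) (hfinT : ∀ j, (ΛbP m j).Finite)
    (S : Finset (Site d × Fin d)) {A : Site d → Fin d → 𝔸} (hA : ∀ b : Site d × Fin d, b ∉ S → A b.1 b.2 = 0) :
    bondPair τ A (QQZdP τ L ΛbP i m (1 : Site d → Fin d → 𝔸ˣ) A) =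
      i.η * ∑ j ∈ Finset.range (m + 1), wQ (d := d) L i.η j *
        ∑ c ∈ (hfinT j).toFinset, (τ (star (linCovIter L (1 : Site d → Fin d → 𝔸ˣ) A j c.1 c.2) * linCovIter L (1 : Site d → Fin d → 𝔸ˣ) A j c.1 c.2)).re := by
  classical
  have hL1 : 1 ≤ L := le_trans (by norm_num) hL
  have hη : 0 < i.η := i.hη
  have hLr : (0 : ℝ) < (L : ℝ) ^ 2 := by positivity
  have hreg : Reg17 L m i.Ω (alphaQ d L / (L : ℝ) ^ 2) (1 : Site d → Fin d → 𝔸ˣ) := reg17_one hL1 (div_pos (alphaQ_pos d hL1) hLr)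
  -- a bound for the finitely supported `A`
  obtain ⟨M₀, hM₀, hAM⟩ : ∃ M₀ : ℝ, 0 ≤ M₀ ∧ ∀ z κ, ‖A z κ‖ ≤ M₀ := by
    refine ⟨∑ b ∈ S, ‖A b.1 b.2‖, Finset.sum_nonneg fun _ _ => norm_nonneg _, fun z κ => ?_⟩
    by_cases hb : (z, κ) ∈ S
    · exact Finset.single_le_sum (f := fun b : Site d × Fin d => ‖A b.1 b.2‖) (fun _ _ => norm_nonneg _) hb
    · rw [hA (z, κ) hb, norm_zero]; exact Finset.sum_nonneg fun _ _ => norm_nonneg _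
  -- the class field at level `j` is `η·𝟙_{Λ_j}·Q_j(1)A`
  have hcls : ∀ j (c : Site d × Fin d), clsField L ΛbP i.η m j (1 : Site d → Fin d → 𝔸ˣ) A c.1 c.2 =
      if c ∈ ΛbP m j then (i.η : ℝ) • linCovIter L (1 : Site d → Fin d → 𝔸ˣ) A j c.1 c.2 else 0 := by
    intro j c
    simp only [clsField]
    split_ifs with hc
    · have hi : iEta i.η A = ((Complex.I : ℂ) * i.η) • A := by funext y τ'; rfl
      rw [hi, linCovIter_one_smul_complex hL1 _ hM₀ hAM j c.1 c.2, smul_smul, ← mul_assoc]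
      have : (-Complex.I * Complex.I * (i.η : ℂ)) = ((i.η : ℝ) : ℂ) := by rw [neg_mul, Complex.I_mul_I, neg_neg, one_mul]
      rw [this, Complex.coe_smul]
    · rfl
  rw [bondPair_eq_sum_of_vanish_off τ S hA]
  have hX : ∀ b : Site d × Fin d, QQZdP τ L ΛbP i m (1 : Site d → Fin d → 𝔸ˣ) A b.1 b.2 =
      ∑ j ∈ Finset.range (m + 1), (wQ (d := d) L i.η j) • linCovIterT τ L 1 j (clsField L ΛbP i.η m j 1 A) b.1 b.2 :=
    fun b => QQZdP_of_reg17 τ L hreg A b.1 b.2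
  simp_rw [hX, map_sum, map_smul, smul_eq_mul]
  rw [Finset.sum_comm, Finset.mul_sum]
  refine Finset.sum_congr rfl fun j hj => ?_
  rw [← Finset.mul_sum]
  have hjm : j ≤ m := Nat.lt_succ_iff.mp (Finset.mem_range.mp hj)
  -- symmetry of the pairing, then the summed transpose identity with the trivial box law (Ω := univ)
  have hsym : ∀ b ∈ S, tauForm τ (A b.1 b.2) (linCovIterT τ L 1 j (clsField L ΛbP i.η m j 1 A) b.1 b.2) =
      tauForm τ (linCovIterT τ L 1 j (clsField L ΛbP i.η m j 1 A) b.1 b.2) (A b.1 b.2) :=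
    fun b _ => (tauForm_isSymm τ hτs).eq _ _
  rw [Finset.sum_congr rfl hsym]
  have hpair := tauForm_linCovIterT_pair τ hL hτp (m := m) (Ω := fun _ => (Set.univ : Set (Site d))) (alphaQ_pos d hL1) le_rfl
    (U₀ := (1 : Site d → Fin d → 𝔸ˣ)) (fun _ _ => (unitaryUnits 𝔸).one_mem) (reg17_one hL1 (alphaQ_pos d hL1)) hjm (hfinT j).toFinset
    (fun _ _ _ _ => Set.mem_univ _) (clsField L ΛbP i.η m j 1 A)
    (fun c hc => by rw [hcls j c, if_neg (fun h => hc ((hfinT j).mem_toFinset.2 h))]) S A hA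
  erw [hpair]
  rw [Finset.mul_sum, Finset.mul_sum, Finset.mul_sum]
  refine Finset.sum_congr rfl fun c hc => ?_
  rw [hcls j c, if_pos ((hfinT j).mem_toFinset.1 hc), tauForm_apply, star_smul, star_trivial, smul_mul_assoc, ← Complex.coe_smul, map_smul,
    smul_eq_mul, Complex.re_ofReal_mul]
  ring

end Squares

/-! ## §4 The kernel conditions: `⟨A, Δ_a(1)A⟩_τ ≤ 0` forces closedness, the Landau projection and all class averages of `A` to vanish -/

section Kernel

variable (τ : 𝔸 →ₗ[ℂ] ℂ) [FiniteDimensional ℝ 𝔸] {L : ℕ}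

/-- `w_j > 0`. [cite: Balaban1985BackgroundPropagators, (3.16) p.393 (bookkeeping)] -/
theorem wQ_pos {L : ℕ} (hL : 1 ≤ L) {η : ℝ} (hη : 0 < η) (j : ℕ) : 0 < wQ (d := d) L η j := by
  have hL0 : (0 : ℝ) < L := by exact_mod_cast hL
  unfold wQ; positivity

/-- ★★★ **THE KERNEL CONDITIONS AT THE FLAT BACKGROUND.**  For the four-letter record `opsAllZd τ L ΛbP ops₀` at a member with finite `Ω₀` and finite class sets,
and a field `A ∈ E(Ω₀)` with `⟨A, Δ_a(1)A⟩_τ ≤ 0` (in particular if `Δ_a(1)A = 0` on the bonds of `Ω₀`): (a) `A` is CLOSED (`D^η_1A = 0` on every plaquette),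
(b) its Landau projection vanishes (`R(1)(D^{η*}_1A) = 0`), (c) every class average vanishes (`LʲηQ_j(1)A = 0` on `Λ_j`, `j ≤ m`) — because
`⟨A, Δ_a(1)A⟩ = Σ|D^η_1A|² + ‖R(1)𝟙D*A‖² + η Σ_j w_j Σ_{Λ_j} |LʲηQ_j(1)A|²` with every summand `≥ 0` (w4's two squares, §3's third, `Δ′(1) = 0`).
[cite: Balaban1985BackgroundPropagators, (3.26) p.395, (3.10) p.392, (3.16) p.393, (3.20)–(3.22) p.394, Thm 3.11 p.416] -/
theorem kernel_conditions_of_bondPair_nonpos [Nontrivial 𝔸] (hτt : ∀ a b : 𝔸, τ (a * b) = τ (b * a))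
    (hτs : ∀ a : 𝔸, τ (star a) = starRingEnd ℂ (τ a)) (hτp : ∀ a : 𝔸, a ≠ 0 → 0 < (τ (star a * a)).re)
    (hL : 2 ≤ L) (ΛbP : ℕ → ℕ → Set (Site d × Fin d)) (ops₀ : ℝ → ZdIdx d L → ℕ → OpsZd d 𝔸) (M : ℝ) (i : ZdIdx d L) (m : ℕ)
    (hΩ : (i.Ω 0).Finite) (hfinT : ∀ j, (ΛbP m j).Finite) {A : Site d → Fin d → 𝔸} (hA : A ∈ domSub (𝔸 := 𝔸) (i.Ω 0))
    (h : bondPair τ A (deltaAOf i.η (opsAllZd τ L ΛbP ops₀ M i m) 1 A) ≤ 0) :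
    (∀ (μ ν : Fin d) (x : Site d), plaqCovDeriv i.η (1 : Site d → Fin d → 𝔸ˣ) A μ ν x = 0) ∧
      B9Eq321LandauProjectionZd.projR τ hΩ.toFinset L m i.η (i.Λs m) 1 (covDivB i.η 1 A) = 0 ∧
      (∀ j, j ≤ m → ∀ c ∈ ΛbP m j, linCovIter L (1 : Site d → Fin d → 𝔸ˣ) A j c.1 c.2 = 0) := by
  classical
  have hL1 : 1 ≤ L := le_trans (by norm_num) hL
  have hη : 0 < i.η := i.hη
  have h1u : ∀ (x : Site d) (κ : Fin d), (1 : Site d → Fin d → 𝔸ˣ) x κ ∈ unitaryUnits 𝔸 := fun _ _ => (unitaryUnits 𝔸).one_mem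
  have hAf : ∀ μ : Fin d, (Function.support fun x => A x μ).Finite := support_finite_of_mem_domSub hΩ hA
  -- the four terms
  have four := bondPair_deltaAOf_eq_four_terms τ i.η (opsAllZd τ L ΛbP ops₀ M i m) 1 hAf
  rw [opsAllZd_Dp, DpZd_one, B9Eq327GreenZd.bondPair_zero_right, add_zero, opsAllZd_QQ] at four
  -- T1 = squares of the plaquette derivative
  have hB : ∀ u ∈ unitaryUnits 𝔸, ∀ a b : 𝔸, tauForm τ (conjR u a) b = tauForm τ a (conjR u⁻¹ b) :=
    fun u hu a b => by rw [tauForm_apply, tauForm_apply]; exact re_trace_star_pair_invariant τ hτt hu a b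
  have hT1 := sum_finsum_pair_Jcur (tauForm τ) (unitaryUnits 𝔸) i.η hB h1u hAf
  have hT1' : ∑ κ : Fin d, ∑ᶠ x, (τ (star (A x κ) * Jcur i.η 1 A κ x)).re =
      ∑ κ : Fin d, ∑ ν ∈ Finset.Iio κ, ∑ᶠ x, (τ (star (plaqCovDeriv i.η 1 A ν κ x) * plaqCovDeriv i.η 1 A ν κ x)).re := hT1
  have hT1nn : 0 ≤ ∑ κ : Fin d, ∑ ν ∈ Finset.Iio κ, ∑ᶠ x, (τ (star (plaqCovDeriv i.η 1 A ν κ x) * plaqCovDeriv i.η 1 A ν κ x)).re :=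
    Finset.sum_nonneg fun κ _ => Finset.sum_nonneg fun ν _ => finsum_nonneg fun x => re_trace_star_mul_self_nonneg' hτp _
  -- T3 = the Landau square
  set s := hΩ.toFinset with hs
  have hD : ∀ (x : Site d) (μ : Fin d), (opsAllZd τ L ΛbP ops₀ M i m).DRDs 1 A x μ =
      covDerivFwd i.η 1 μ (B9Eq321LandauProjectionZd.projR τ s L m i.η (i.Λs m) 1 (covDivB i.η 1 A)) x := fun x μ => by
    rw [opsAllZd_DRDs]; exact opsLandau_DRDs_of_finite τ _ M i m hΩ 1 A x μ
  have hT3 : bondPair τ A ((opsAllZd τ L ΛbP ops₀ M i m).DRDs 1 A) =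
      ∑ μ : Fin d, ∑ᶠ x, (τ (star (A x μ) * covDerivFwd i.η 1 μ
        (B9Eq321LandauProjectionZd.projR τ s L m i.η (i.Λs m) 1 (covDivB i.η 1 A)) x)).re := by
    simp only [bondPair, hD]
  have hT3nn := finsum_re_trace_bond_DRD_nonneg (τ := τ) (s := s) (L := L) (m := m) (η := i.η) (Λs := i.Λs m)
    (U₀ := (1 : Site d → Fin d → 𝔸ˣ)) hτt hτs hτp h1u hAf
  -- T4 = the averaging squares
  set S := (setOf_bondTouches_finite (d := d) hΩ).toFinset with hS
  have hAS : ∀ b : Site d × Fin d, b ∉ S → A b.1 b.2 = 0 :=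
    fun b hb => hA b.1 b.2 fun hbt => hb ((setOf_bondTouches_finite hΩ).mem_toFinset.2 hbt)
  have hT4 := bondPair_QQZdP_one_eq τ hτs hτp hL ΛbP i m hfinT S hAS
  have hT4nn : 0 ≤ ∑ j ∈ Finset.range (m + 1), wQ (d := d) L i.η j *
      ∑ c ∈ (hfinT j).toFinset, (τ (star (linCovIter L (1 : Site d → Fin d → 𝔸ˣ) A j c.1 c.2) * linCovIter L 1 A j c.1 c.2)).re :=
    Finset.sum_nonneg fun j _ => mul_nonneg (wQ_pos hL1 hη j).le (Finset.sum_nonneg fun c _ => re_trace_star_mul_self_nonneg' hτp _)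
  rw [four, hT1', hT3, hT4] at h
  have hT1z : ∑ κ : Fin d, ∑ ν ∈ Finset.Iio κ, ∑ᶠ x, (τ (star (plaqCovDeriv i.η 1 A ν κ x) * plaqCovDeriv i.η 1 A ν κ x)).re = 0 := by
    nlinarith [mul_nonneg hη.le hT4nn]
  have hT3z : ∑ μ : Fin d, ∑ᶠ x, (τ (star (A x μ) * covDerivFwd i.η 1 μ
      (B9Eq321LandauProjectionZd.projR τ s L m i.η (i.Λs m) 1 (covDivB i.η 1 A)) x)).re = 0 := by
    nlinarith [mul_nonneg hη.le hT4nn]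
  have hT4z : ∑ j ∈ Finset.range (m + 1), wQ (d := d) L i.η j *
      ∑ c ∈ (hfinT j).toFinset, (τ (star (linCovIter L (1 : Site d → Fin d → 𝔸ˣ) A j c.1 c.2) * linCovIter L 1 A j c.1 c.2)).re = 0 := by
    nlinarith [mul_nonneg hη.le hT4nn]
  refine ⟨?_, (finsum_re_trace_bond_DRD_eq_zero_iff (τ := τ) (s := s) (L := L) (m := m) (η := i.η) (Λs := i.Λs m)
    (U₀ := (1 : Site d → Fin d → 𝔸ˣ)) hτt hτs hτp h1u hAf).1 hT3z, ?_⟩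
  · -- (a) closedness
    have hlt : ∀ κ ν : Fin d, ν < κ → ∀ x, plaqCovDeriv i.η (1 : Site d → Fin d → 𝔸ˣ) A ν κ x = 0 := by
      intro κ ν hνκ x
      have h1 := (Finset.sum_eq_zero_iff_of_nonneg fun κ _ =>
        Finset.sum_nonneg fun ν _ => finsum_nonneg fun x => re_trace_star_mul_self_nonneg' hτp _).1 hT1z κ (Finset.mem_univ κ)
      have h2 := (Finset.sum_eq_zero_iff_of_nonneg fun ν _ => finsum_nonneg fun x => re_trace_star_mul_self_nonneg' hτp _).1 h1 ν
        (Finset.mem_Iio.2 hνκ)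
      have hfs : (Function.support fun x => (τ (star (plaqCovDeriv i.η (1 : Site d → Fin d → 𝔸ˣ) A ν κ x) *
          plaqCovDeriv i.η 1 A ν κ x)).re).Finite := by
        refine (B9Eq326GaugeTermSquareZd.support_plaqCovDeriv_finite (U₀ := (1 : Site d → Fin d → 𝔸ˣ)) i.η hAf ν κ).subset
          fun x hx => ?_
        rw [Function.mem_support] at hx ⊢
        intro h0; exact hx (by rw [h0, star_zero, zero_mul, map_zero, Complex.zero_re])
      exact eq_zero_of_re_trace_star_mul_self_eq_zero hτp
        (finsum_eq_zero_iff_of_nonneg' hfs (fun x => re_trace_star_mul_self_nonneg' hτp _) h2 x)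
    intro μ ν x
    rcases lt_trichotomy μ ν with hμν | rfl | hνμ
    · exact hlt ν μ hμν x
    · rw [B8Eq146AExpansion.plaqCovDeriv_eq_covDerivFwd, sub_self]
    · -- `F μ ν = −F ν μ`
      have h := hlt μ ν hνμ x
      rw [B8Eq146AExpansion.plaqCovDeriv_eq_covDerivFwd] at h ⊢
      rw [← neg_sub, h, neg_zero]
  · -- (c) class averages
    intro j hj c hc
    have h1 := (Finset.sum_eq_zero_iff_of_nonneg fun j _ => mul_nonneg (wQ_pos (d := d) hL1 hη j).le
      (Finset.sum_nonneg fun c _ => re_trace_star_mul_self_nonneg' hτp _)).1 hT4z j (Finset.mem_range.2 (Nat.lt_succ_of_le hj))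
    have h2 : ∑ c ∈ (hfinT j).toFinset, (τ (star (linCovIter L (1 : Site d → Fin d → 𝔸ˣ) A j c.1 c.2) * linCovIter L 1 A j c.1 c.2)).re = 0 := by
      rcases mul_eq_zero.1 h1 with h0 | h0
      · exact absurd h0 (wQ_pos (d := d) hL1 hη j).ne'
      · exact h0
    exact eq_zero_of_re_trace_star_mul_self_eq_zero hτp
      ((Finset.sum_eq_zero_iff_of_nonneg fun c _ => re_trace_star_mul_self_nonneg' hτp _).1 h2 c ((hfinT j).mem_toFinset.2 hc))

end Kernel

/-! ## §5 The combinatorial half at a cube member (dag-n05-w3's `B8Ineq159FlatCubeMemberKernel` §1∕§3, fibre generalised): class averages zero ⇒ block sums zero -/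

section Rays

variable {V : Type*} [AddCommGroup V]

/-- `(x − e_μ)_i = x_i − [i = μ]`. [folklore] [cite: Balaban1985RegularSpaces, p.77 (bond convention, bookkeeping)] -/
private theorem sub_e_apply' (x : Site d) (μ i : Fin d) : (x - e μ) i = x i - (if i = μ then 1 else 0) := by
  have := add_zsmul_e_apply x (-1) μ i
  rw [neg_one_smul, ← sub_eq_add_neg] at this
  rw [this]; split_ifs <;> ring

/-- ★ **RAY ESCAPE** (dag-n05-w3's `B8Ineq159FlatCubeMemberKernel.ray_escape` VERBATIM, fibre `ℂ ↦ V`): a `V`-valued `T` vanishing outside `[lo, hi]` and constant across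
every bond with an end in `[lo, hi]` and no end in the inner box `[ilo, ihi]` vanishes outside the inner box. [cite: Balaban1984PropagatorsII, (2.3) p.224, (2.7) p.224; Balaban1985RegularSpaces, (1.31) p.82] -/
theorem ray_escape_fibre {lo hi ilo ihi : Site d} {T : Site d → V} (hout : ∀ w, ¬ InBox lo hi w → T w = 0)
    (hbond : ∀ (w : Site d) (i : Fin d), (InBox lo hi w ∨ InBox lo hi (w + e i)) →
      ¬ InBox ilo ihi w → ¬ InBox ilo ihi (w + e i) → T (w + e i) = T w) :
    ∀ w, ¬ InBox ilo ihi w → T w = 0 := by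
  have hup : ∀ (i : Fin d) (n : ℕ) (v : Site d), ihi i < v i → (hi i + 1 - v i).toNat = n → T v = 0 := by
    intro i n
    induction n with
    | zero =>
      intro v _ hn
      exact hout v (not_inBox_of_hi_lt (i := i) (by omega))
    | succ n ih =>
      intro v hv hn
      by_cases hbox : InBox lo hi v
      · have h1 : ihi i < (v + e i) i := by rw [add_e_apply, if_pos rfl]; omega
        rw [← hbond v i (Or.inl hbox) (not_inBox_of_hi_lt hv) (not_inBox_of_hi_lt h1)]
        exact ih (v + e i) h1 (by rw [add_e_apply, if_pos rfl]; omega)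
      · exact hout v hbox
  have hdown : ∀ (i : Fin d) (n : ℕ) (v : Site d), v i < ilo i → (v i + 1 - lo i).toNat = n → T v = 0 := by
    intro i n
    induction n with
    | zero =>
      intro v _ hn
      exact hout v (not_inBox_of_lt_lo (i := i) (by omega))
    | succ n ih =>
      intro v hv hn
      by_cases hbox : InBox lo hi v
      · have h1 : (v - e i) i < ilo i := by rw [sub_e_apply', if_pos rfl]; omega
        have h2 := hbond (v - e i) i (Or.inr (by rwa [sub_add_cancel])) (not_inBox_of_lt_lo h1)
          (by rw [sub_add_cancel]; exact not_inBox_of_lt_lo hv)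
        rw [sub_add_cancel] at h2
        rw [h2]
        exact ih (v - e i) h1 (by rw [sub_e_apply', if_pos rfl]; omega)
      · exact hout v hbox
  intro w hw
  have hw' : ∃ i, w i < ilo i ∨ ihi i < w i := by
    by_contra h
    push Not at h
    exact hw fun i => ⟨(h i).1, (h i).2⟩
  obtain ⟨i, hi | hi⟩ := hw'
  · exact hdown i _ w hi rfl
  · exact hup i _ w hi rfl

/-- block nesting of the block sums, fibre `V`. [cite: Balaban1985Averaging, (2)–(3) p.17] -/
theorem sum_blockSites_pow_succ_fibre {L : ℕ} (hL : 1 ≤ L) (j : ℕ) (w : Site d) (lam : Site d → V) :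
    ∑ x ∈ blockSites (L ^ (j + 1)) w, lam x = ∑ w' ∈ blockSites L w, ∑ x ∈ blockSites (L ^ j) w', lam x := by
  rw [pow_succ, B7BlockGeometry.sum_blockSites_mul (L ^ j) L (by positivity) (by omega)]

/-- ★★ **ZERO CLASS DATA FORCE VANISHING BLOCK SUMS OFF THE INNER CUBES** (dag-n05-w3's `blockSum_eq_zero_of_classData` VERBATIM, fibre `ℂ ↦ V`): `λ : ℤᵈ → V`
vanishing outside `□₀` with equal `Lʲ`-block sums at the two ends of every bond of print's class `cubeLamBP … m j` (`j ≤ m`) has vanishing `Lʲ`-block sums at every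
level-`j` site off `□_{j+1}^{(j)}` (`j < m`), everywhere at `j = m`. [cite: Balaban1984PropagatorsII, (2.3) p.224, (2.7) p.224; Balaban1985RegularSpaces, (1.31) p.82, (1.131) p.99] -/
theorem blockSum_eq_zero_of_classData_fibre (hd : 1 ≤ d) {L : ℕ} (hL : 1 ≤ L) (a : Site d) (M ρ : ℕ) {k m : ℕ}
    (hm : m ≤ k) {lam : Site d → V} (hout : ∀ x, x ∉ cube L a M ρ k 0 → lam x = 0)
    (hdata : ∀ j, j ≤ m → ∀ c ∈ cubeLamBP L a M ρ k m j,
      ∑ x ∈ blockSites (L ^ j) (c.1 + e c.2), lam x = ∑ x ∈ blockSites (L ^ j) c.1, lam x) :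
    ∀ j, j ≤ m → ∀ w : Site d, (j < m → ¬ InBox (inLo L a ρ k j) (inHi L a M ρ k j) w) →
      ∑ x ∈ blockSites (L ^ j) w, lam x = 0 := by
  have hempty : ∀ w : Site d, ¬ InBox (fun _ => (1 : ℤ)) (fun _ => (0 : ℤ)) w := by
    intro w h
    have := h ⟨0, by omega⟩
    dsimp only at this
    omega
  have hlevel : ∀ j, j ≤ m → ∀ (ilo ihi : Site d),
      (∀ w, InBox ilo ihi w ↔ (j < m ∧ InBox (inLo L a ρ k j) (inHi L a M ρ k j) w)) →
      (∀ w, ¬ InBox (sqLo L a ρ k j) (sqHi L a M ρ k j) w → ∑ x ∈ blockSites (L ^ j) w, lam x = 0) →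
      ∀ w, ¬ InBox ilo ihi w → ∑ x ∈ blockSites (L ^ j) w, lam x = 0 := by
    intro j hj ilo ihi hinner houtj
    refine ray_escape_fibre houtj fun w i hends h1 h2 => hdata j hj (w, i) ⟨hj, hends, fun hjm => ?_⟩
    exact ⟨fun h => h1 ((hinner w).2 ⟨hjm, h⟩), fun h => h2 ((hinner (w + e i)).2 ⟨hjm, h⟩)⟩
  intro j
  induction j with
  | zero =>
    intro hj w hw
    rw [pow_zero, sum_blockSites_one]
    have hout0 : ∀ w, ¬ InBox (sqLo L a ρ k 0) (sqHi L a M ρ k 0) w → ∑ x ∈ blockSites (L ^ 0) w, lam x = 0 := by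
      intro w hw
      rw [pow_zero, sum_blockSites_one]
      exact hout w hw
    by_cases hm0 : 0 < m
    · have := hlevel 0 hj (inLo L a ρ k 0) (inHi L a M ρ k 0) (fun w => by simp [hm0]) hout0 w (hw hm0)
      rwa [pow_zero, sum_blockSites_one] at this
    · have := hlevel 0 hj (fun _ => 1) (fun _ => 0) (fun w => by simp [hm0, hempty w]) hout0 w (hempty w)
      rwa [pow_zero, sum_blockSites_one] at this
  | succ j ih =>
    intro hj w hw
    have hjm : j < m := by omega
    have hjk : j < k := by omega
    have houtS : ∀ w, ¬ InBox (sqLo L a ρ k (j + 1)) (sqHi L a M ρ k (j + 1)) w →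
        ∑ x ∈ blockSites (L ^ (j + 1)) w, lam x = 0 := by
      intro w hw
      rw [sum_blockSites_pow_succ_fibre hL]
      refine Finset.sum_eq_zero fun w' hw' => ih hjm.le w' fun _ hin => hw ?_
      have := inBox_sq_succ_blockMap_of_inBox_in hL a M ρ hjk hin
      rwa [blockMap_eq_of_mem_blockSites hL hw'] at this
    by_cases hjm' : j + 1 < m
    · exact hlevel (j + 1) hj (inLo L a ρ k (j + 1)) (inHi L a M ρ k (j + 1)) (fun w => by simp [hjm']) houtS w (hw hjm')
    · exact hlevel (j + 1) hj (fun _ => 1) (fun _ => 0) (fun w => by simp [hjm', hempty w]) houtS w (hempty w)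

end Rays

/-! ## §6 ASSEMBLY: at every cube member of (1.131) with print's class `cubeLamBP`, the genuine `Δ_a(1)` is positive definite on the Hermitian fields of `E(□₀)` -/

section Assembly

variable (τ : 𝔸 →ₗ[ℂ] ℂ) [FiniteDimensional ℝ 𝔸] {L : ℕ}

omit [FiniteDimensional ℝ 𝔸] in
/-- `D^{η*}_{U₀}` is real-homogeneous in the bond field. [cite: Balaban1985RegularSpaces, (1.1) p.76 (bookkeeping)] -/
theorem covDivB_smul_real (η : ℝ) (U₀ : Site d → Fin d → 𝔸ˣ) (c : ℝ) (A : Site d → Fin d → 𝔸) (x : Site d) :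
    covDivB η U₀ (c • A) x = c • covDivB η U₀ A x := by
  simp only [covDivB, covDeriv, Pi.smul_apply, Finset.smul_sum, smul_sub, B7Eq78Linearization.conjR_smul_real, smul_comm c (η⁻¹ : ℝ)]

omit [FiniteDimensional ℝ 𝔸] in
/-- the Landau projection is real-homogeneous in its input. [cite: Balaban1985BackgroundPropagators, (3.21)–(3.22) p.394 (bookkeeping)] -/
theorem projR_smul_real (s : Finset (Site d)) (L m : ℕ) (η : ℝ) (Λs : ℕ → Set (Site d)) (U₀ : Site d → Fin d → 𝔸ˣ) (c : ℝ) (f : Site d → 𝔸) :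
    projR τ s L m η Λs U₀ (c • f) = c • projR τ s L m η Λs U₀ f := by
  have hmem : (⟨(↑s : Set (Site d)).indicator (c • f), B9Eq321LandauProjectionZd.indicator_mem_suppSub s _⟩ :
      B9Eq321LandauProjectionZd.suppSub (𝔸 := 𝔸) s) =
      c • ⟨(↑s : Set (Site d)).indicator f, B9Eq321LandauProjectionZd.indicator_mem_suppSub s _⟩ := by
    apply Subtype.ext
    show (↑s : Set (Site d)).indicator (c • f) = c • (↑s : Set (Site d)).indicator f
    funext x
    by_cases hx : x ∈ (↑s : Set (Site d))
    · rw [Set.indicator_of_mem hx, Pi.smul_apply, Pi.smul_apply, Set.indicator_of_mem hx]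
    · rw [Set.indicator_of_notMem hx, Pi.smul_apply, Set.indicator_of_notMem hx, smul_zero]
  rw [projR, projR, hmem, map_smul, Submodule.coe_smul]

/-- the class `cubeLamBP … m j` is finite (its bonds touch the box `□_j^{(j)}`). [cite: Balaban1984PropagatorsII, (2.3) p.224 (bookkeeping)] -/
theorem cubeLamBP_finite (L : ℕ) (a : Site d) (Mc ρ k m j : ℕ) : (cubeLamBP L a Mc ρ k m j).Finite := by
  refine (setOf_bondTouches_finite (d := d) (B8Eq191FlatLettersCubeMember.inBox_finite (sqLo L a ρ k j) (sqHi L a Mc ρ k j))).subset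
    fun c hc => ?_
  exact hc.2.1

/-- ★★★ **[B9] THEOREM 3.11 AT THE FLAT BACKGROUND ON PRINT'S CARRIER, EVERY CUBE MEMBER**: at a cube member `{□_j}` of (1.131) (`Ω = cubeFam false L a Mc ρ k`,
`Λs = cubeLamS …`, `d ≥ 2`, `L ≥ 2`), every truncation `m ≤ k`, print's class `cubeLamBP` (WITH the level-`0` crossing bonds), a faithful Hermitian tracial `τ` on a
finite-dimensional fibre: a HERMITIAN field `A ∈ E(□₀)` with `⟨A, Δ_a(1)A⟩_τ ≤ 0` for the genuine four-letter `Δ_a(1)` (`opsAllZd`) is ZERO.  Chain: §4 kernel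
conditions (closed, `R(1)D*A = 0`, class averages zero) ⇒ §0 Poincaré (`A = dλ`, `λ` Hermitian, supported in `□₀`) ⇒ §5 all block sums of `λ` vanish off the
inner cubes (dag-n05-w3's rays) ⇒ `λ ∈ N_𝔤(Q′(1))` ⇒ `R(1)` fixes `𝟙Δλ`, so `Δλ = 0` on `□₀` ⇒ §1 energy ⇒ `dλ = 0`. [cite: Balaban1985BackgroundPropagators, Thm 3.11 p.416 («Δ_a … positive definite»), (3.26) p.395, (3.16) p.393, (3.20)–(3.22) p.394, (3.115) p.418; Balaban1984PropagatorsII, (2.11) p.225, (2.3) p.224; Balaban1985RegularSpaces, (1.131) p.99, p.77] -/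
theorem flat_kernel_herm_cube [Nontrivial 𝔸] (hτt : ∀ a b : 𝔸, τ (a * b) = τ (b * a))
    (hτs : ∀ a : 𝔸, τ (star a) = starRingEnd ℂ (τ a)) (hτp : ∀ a : 𝔸, a ≠ 0 → 0 < (τ (star a * a)).re)
    (hd2 : 2 ≤ d) (hL : 2 ≤ L) (ops₀ : ℝ → ZdIdx d L → ℕ → OpsZd d 𝔸) (M : ℝ) (i : ZdIdx d L) {a : Site d} {Mc ρ : ℕ}
    (hΩ : i.Ω = B8Eq131CubesAdmissible.cubeFam false L a Mc ρ i.k) (hΛs : i.Λs = B8CubeMemberZd.cubeLamS L a Mc ρ i.k) {m : ℕ} (hm : m ≤ i.k)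
    {A : Site d → Fin d → 𝔸} (hA : A ∈ domSub (𝔸 := 𝔸) (i.Ω 0)) (hsa : ∀ (y : Site d) (τ' : Fin d), IsSelfAdjoint (A y τ'))
    (h : bondPair τ A (deltaAOf i.η (opsAllZd τ L (cubeLamBP L a Mc ρ i.k) ops₀ M i m) 1 A) ≤ 0) : A = 0 := by
  classical
  have hL1 : 1 ≤ L := le_trans (by norm_num) hL
  have hd1 : 1 ≤ d := le_trans (by norm_num) hd2
  have hη : 0 < i.η := i.hη
  have h1u : ∀ (x : Site d) (κ : Fin d), (1 : Site d → Fin d → 𝔸ˣ) x κ ∈ unitaryUnits 𝔸 := fun _ _ => (unitaryUnits 𝔸).one_mem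
  have hΩ0 : i.Ω 0 = cube L a Mc ρ i.k 0 := by rw [hΩ, B8Eq131CubesAdmissible.cubeFam_false_zero]
  have hfin : (i.Ω 0).Finite := by
    rw [hΩ0]; exact B8Eq191FlatLettersCubeMember.inBox_finite (sqLo L a ρ i.k 0) (sqHi L a Mc ρ i.k 0)
  -- §4: the kernel conditions
  obtain ⟨hclosed, hR, havg⟩ := kernel_conditions_of_bondPair_nonpos τ hτt hτs hτp hL (cubeLamBP L a Mc ρ i.k) ops₀ M i m hfin
    (fun j => cubeLamBP_finite L a Mc ρ i.k m j) hA h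
  -- closedness in difference form
  have hF : ∀ μ ν x, A (x + e μ) ν - A x ν = A (x + e ν) μ - A x μ := by
    intro μ ν x
    have h0 := hclosed μ ν x
    rw [B8Eq146AExpansion.plaqCovDeriv_eq_covDerivFwd] at h0
    simp only [covDerivFwd, Pi.one_apply, B8Ineq132.one_conjR, ← smul_sub] at h0
    exact sub_eq_zero.1 ((smul_eq_zero.1 h0).resolve_left (inv_ne_zero hη.ne'))
  -- §0: Poincaré with a Hermitian potential supported in `□₀`
  have hout : ∀ x τ', ¬ BondTouches {y | InBox (sqLo L a ρ i.k 0) (sqHi L a Mc ρ i.k 0) y} x τ' → A x τ' = 0 := by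
    intro x τ' hb; apply hA x τ'; rwa [hΩ0]
  obtain ⟨lam, hgrad, hsupp, hlsa⟩ := exists_grad_of_closed hd2 (sqLo L a ρ i.k 0) (sqHi L a Mc ρ i.k 0) hout hF
    (fun v => IsSelfAdjoint v) (IsSelfAdjoint.zero _) (fun _ _ ha hb => ha.add hb) (fun _ ha => ha.neg) hsa
  -- a bound for `λ`
  obtain ⟨Λ, hΛ⟩ : ∃ Λ : ℝ, ∀ x, ‖lam x‖ ≤ Λ := by
    refine ⟨∑ x ∈ (B8Eq191FlatLettersCubeMember.inBox_finite (sqLo L a ρ i.k 0) (sqHi L a Mc ρ i.k 0)).toFinset, ‖lam x‖, fun x => ?_⟩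
    by_cases hx : InBox (sqLo L a ρ i.k 0) (sqHi L a Mc ρ i.k 0) x
    · exact Finset.single_le_sum (f := fun x => ‖lam x‖) (fun _ _ => norm_nonneg _) ((Set.Finite.mem_toFinset _).2 hx)
    · rw [hsupp x hx, norm_zero]; exact Finset.sum_nonneg fun _ _ => norm_nonneg _
  have hAeq : A = fun y τ' => (1 : ℂ) • (lam (y + e τ') - lam y) := by
    funext y τ'; rw [one_smul, hgrad]
  -- §5: class averages zero ⇒ equal block sums across class bonds ⇒ all block sums vanish off the inner cubes
  have hdata : ∀ j, j ≤ m → ∀ c ∈ cubeLamBP L a Mc ρ i.k m j,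
      ∑ x ∈ blockSites (L ^ j) (c.1 + e c.2), lam x = ∑ x ∈ blockSites (L ^ j) c.1, lam x := by
    intro j hj c hc
    have h0 := havg j hj c hc
    rw [hAeq, B9SupplySockB9P3ZdSkewGaugeMode.linCovIter_one_grad_alg hL1 (1 : ℂ) hΛ j c.1 c.2, one_smul, smul_eq_zero] at h0
    rcases h0 with h0 | h0
    · exact absurd h0 (inv_ne_zero (by positivity))
    · exact (sub_eq_zero.1 h0)
  have hout' : ∀ x, x ∉ cube L a Mc ρ i.k 0 → lam x = 0 := fun x hx => hsupp x (by rwa [mem_cube_zero_iff] at hx)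
  have hS := blockSum_eq_zero_of_classData_fibre hd1 hL1 a Mc ρ hm hout' hdata
  -- `λ ∈ N_𝔤(Q′(1))`
  have hgn : lam ∈ gaugeNull hfin.toFinset L m (i.Λs m) (1 : Site d → Fin d → 𝔸ˣ) := by
    refine ⟨hlsa, fun x hx => hout' x (by rwa [hfin.mem_toFinset, hΩ0] at hx), fun j hj y hy => ?_⟩
    rw [B8Eq119TwistedAxial.bgT_one, B7Eq214FlatQprime.QprimeIter_one_eq_sum_blockSites hL1, ← Finset.smul_sum,
      hS j hj y (fun hjm hin => ?_), smul_zero]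
    rw [hΛs, B8CubeMemberZd.cubeLamS_of_lt L a Mc ρ i.k hjm] at hy
    exact hy.2 (by omega) hin
  -- the Landau projection of `Δλ` vanishes
  have hDA : (fun z μ => covDerivFwd i.η (1 : Site d → Fin d → 𝔸ˣ) μ lam z) = (i.η⁻¹ : ℝ) • A := by
    funext z μ
    simp only [covDerivFwd, Pi.one_apply, B8Ineq132.one_conjR, Pi.smul_apply, hgrad]
  have hRlam : projR τ hfin.toFinset L m i.η (i.Λs m) 1 (covLap i.η 1 lam) = 0 := by
    have : covLap i.η (1 : Site d → Fin d → 𝔸ˣ) lam = (i.η⁻¹ : ℝ) • covDivB i.η 1 A := by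
      funext x
      rw [← B9Eq326GaugeTermSquareZd.covDivB_gaugeMode, hDA, covDivB_smul_real]; rfl
    rw [this, projR_smul_real, hR, smul_zero]
  -- §1: energy ⇒ `dλ = 0`
  have hD := covDerivFwd_eq_zero_of_gaugeNull_of_projR_eq_zero (τ := τ) i.η hτt hτs hτp h1u hgn hRlam
  funext y τ'
  have h1 := congrFun (congrFun hDA y) τ'
  simp only [Pi.smul_apply, hD τ' y] at h1
  have h2 : A y τ' = 0 := (smul_eq_zero.1 h1.symm).resolve_left (inv_ne_zero hη.ne')
  rw [h2]; rfl

/-- ★★★ **POSITIVE DEFINITENESS AT THE FLAT BACKGROUND ON `E_𝔤(□₀)`**: at every cube member, every `m ≤ k`, class `cubeLamBP`, every HERMITIAN `0 ≠ A ∈ E(□₀)` has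
`0 < ⟨A, Δ_a(1)A⟩_τ` for the genuine four-letter record — [B9] Theorem 3.11's «Δ_a positive definite» at `U = 1` on print's carrier and class ([4]'s `G_□(1) > 0`).
[cite: Balaban1985BackgroundPropagators, Thm 3.11 p.416, (3.26) p.395; Balaban1984PropagatorsII, (2.11) p.225] -/
theorem flat_posDef_herm_cube [Nontrivial 𝔸] (hτt : ∀ a b : 𝔸, τ (a * b) = τ (b * a))
    (hτs : ∀ a : 𝔸, τ (star a) = starRingEnd ℂ (τ a)) (hτp : ∀ a : 𝔸, a ≠ 0 → 0 < (τ (star a * a)).re)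
    (hd2 : 2 ≤ d) (hL : 2 ≤ L) (ops₀ : ℝ → ZdIdx d L → ℕ → OpsZd d 𝔸) (M : ℝ) (i : ZdIdx d L) {a : Site d} {Mc ρ : ℕ}
    (hΩ : i.Ω = B8Eq131CubesAdmissible.cubeFam false L a Mc ρ i.k) (hΛs : i.Λs = B8CubeMemberZd.cubeLamS L a Mc ρ i.k) {m : ℕ} (hm : m ≤ i.k)
    {A : Site d → Fin d → 𝔸} (hA : A ∈ domSub (𝔸 := 𝔸) (i.Ω 0)) (hsa : ∀ (y : Site d) (τ' : Fin d), IsSelfAdjoint (A y τ')) (hA0 : A ≠ 0) :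
    0 < bondPair τ A (deltaAOf i.η (opsAllZd τ L (cubeLamBP L a Mc ρ i.k) ops₀ M i m) 1 A) := by
  by_contra h
  exact hA0 (flat_kernel_herm_cube τ hτt hτs hτp hd2 hL ops₀ M i hΩ hΛs hm hA hsa (not_lt.1 h))

end Assembly

end Literature.MathematicalPhysics.QuantumFieldTheory.Balaban1983to89.B9Thm311FlatHermKernelZd

end
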